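/-
Copyright: the b2b-balaban T⁴-continuum CRUX team, row NE7b leaf lineages `t4-ne7b-formalise-leaf-06` (gen 149–150) and
`t4-ne7b-formalise-leaf-05` (gen 150). Project licence.
-/
import Summits.QuantumFields.BalabanUV.T4Continuum.Spine.NE7b.FibreWindowHessian
import Summits.QuantumFields.BalabanUV.T4Continuum.Spine.NE7b.ConvexWindowBrascampLieb
import Summits.QuantumFields.BalabanUV.T4Continuum.Spine.NE7b.HessianFormFirstOrder

/-!
# THE TWO-SIDED HESSIAN DISPLAY OF A FIBRE-WINDOW MARGINAL: `a − b²∕λ ≤ D²V⁺(x)[u,u] ≤ A` — Brascamp–Lieb's formula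
# (`…FibreWindowHessian` §6) with the variance DROPPED (upper) and with the variance BOUNDED by Brascamp–Lieb's inequality ON THE
# FIBRE (the OWNER's `…ConvexWindowBrascampLieb` BY NAME; lower); the letters read fibrewise at the base point, in Hessian currency
# throughout — «HESSIAN IN ⟹ HESSIAN OUT» across one fluctuation integral (row NE7b, node U5c; residual (R2′) family (2), letter (ℓ1))

Cell `pub-balaban`, sub-cell `t4`, spine estimate NE7b (`T4WeightBudget.RelWeightBound`; the cell's OWN estimate — NOT PRINTED in
[Bałaban 1983–89], NOT PROVED).  Crux-route work under `Spine/NE7b/` by two row leaves (§1–§3 `t4-ne7b-formalise-leaf-06` gen 149;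
§4–§9 `t4-ne7b-formalise-leaf-05` gen 150, OFFER ο-leaf05-g150-1 adopted by W-leaf06-g149-1; module docstring re-cut by leaf-06 gen 150
per the chair's DOCFIX δ-X-FWHB-g82-1); NOTHING of Bałaban's is named or asserted; no `def`; zero `sorry`.
Imports: `…FibreWindowHessian` (the `Cᴺ` marginal and Brascamp–Lieb's formula), `…ConvexWindowBrascampLieb` (the windowed
Brascamp–Lieb variance inequality, (12)), `…HessianFormFirstOrder` (Hessian floor ⟹ first-order letter).

WHAT IS PROVED ([folklore]; the variance inequality is Brascamp–Lieb 1976 Thm 4.1 ∕ 4.3, taken from the tree BY NAME):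
* §1 `sq_integral_mul_le` — weighted Cauchy–Schwarz on a window, `(∫_F w g)² ≤ (∫_F w)(∫_F w g²)` for `w ≥ 0`.
* §2 **`iteratedFDeriv_two_negLogFibreWindowMass_le_tiltedMean`** — UPPER: `V ∈ C²`, `F` measurable bounded, `volume F ≠ 0` ⊢
  `D²V⁺(x)[u,u] ≤ ⟨D²V(x,·)[(u,0),(u,0)]⟩_x` (tilted fibre mean; the variance has a sign).
* §3 `iteratedFDeriv_two_negLogFibreWindowMass_le_of_fibrewise` — `D²V(x,y)[(u,0),(u,0)] ≤ r` on the fibre ⊢ `D²V⁺(x)[u,u] ≤ r`.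
* §4 `integral_tilted_restrict_eq_div` — tilted fibre integrals as quotients of window integrals.
* §5 **`fibre_variance_le`** — Brascamp–Lieb on the fibre through `x`, test function `∂ᵤV(x,·)`: `F` convex, the first-order
  `λ`-letter of `V(x,·)` on `F` ⊢ `⟨(∂ᵤV)²⟩_x − ⟨∂ᵤV⟩_x² ≤ λ⁻¹⟨‖D_y∂ᵤV‖²⟩_x` ((12)'s `variance_windowTilted_le` BY NAME).
* §6 **`tiltedMean_schur_le_iteratedFDeriv_two_negLogFibreWindowMass`** — LOWER: `⟨D²V[(u,0),(u,0)] − λ⁻¹‖D_y∂ᵤV‖²⟩_x ≤ D²V⁺(x)[u,u]`;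
  `le_…_of_fibrewise`; **`le_…_of_bounds`** (`a ≤ D²V[(u,0),(u,0)]`, `‖D_y∂ᵤV‖ ≤ b` on `F` ⊢ `a − b²∕λ ≤ D²V⁺(x)[u,u]`).
* §7 `hessian_twoSided_of_fibrewise` — `a − b²∕λ ≤ D²V⁺(x)[u,u] ≤ A`.
* §8 `norm_fderiv_baseDeriv_le_of_mixed` (the mixed block `|D²V(x,y)[(0,v),(u,0)]| ≤ b‖v‖` bounds `‖D_y∂ᵤV(x,y)‖`),
  `le_…_of_hessianLetters` (the fibre HESSIAN floor `λ‖v‖² ≤ D²(V(x,·))(y)[v,v]` supplies the first-order letter by HFFO BY NAME).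
* §9 **`hessian_twoSided_of_hessianLetters`** — HESSIAN IN ⟹ HESSIAN OUT: fibre floor `λ`, base block `[a, A]`, mixed block `b` on
  the fibre through `x` ⊢ `a − b²∕λ ≤ D²V⁺(x)[u,u] ≤ A`.

NOT HERE (honest): the majorant ∕ matrix form of the lower display (`…ConvexWindowVarianceMajorant`, leaf-04: `D²V⁺ ≥ ⟨∂ᵤᵤV − h⟩` for
any admissible majorant `h`, sharper than the scalar `λ⁻¹‖D_y∂ᵤV‖²`); the constant-block Schur form; joint ∕ unbounded windows;
nonlinear charts (`…HessianChartTransport`, leaf-01); the letters `(λ, a, A, b)` from analyticity (`…AnalyticHessianLetter`, leaf-06)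
or from WHICH of print's steps — (A3) ∕ (A1c), NC-NE7b-α UNRULED; anything of Bałaban's.  BY-NAME EFFECT ON THE WALL: NONE.
NE7b NOT PRINTED ∕ NOT PROVED; spine PROVED 0∕9; rung (B)+1 on a FINITE torus — NOT infinite volume, NOT the mass gap, NOT Clay.
HONEST DEPENDENCY: continuum YM on T⁴ ⇐ BetaPertH ∧ nine spine estimates (0/9 proved); BetaPertH ⇐ (D1) ∧ (D4) ∧ CAP+tail.
-/

set_option autoImplicit false

noncomputable section

open MeasureTheory Real Set Bornology

namespace Summit.QuantumFields.BalabanUV.T4Continuum.NE7b.FibreWindowHessianBounds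

open Summit.QuantumFields.BalabanUV.T4Continuum.NE7b.FibreWindowHessian
open Summit.QuantumFields.BalabanUV.T4Continuum.NE7b.ConvexWindowBrascampLieb
open Summit.QuantumFields.BalabanUV.T4Continuum.NE7b.HessianFormFirstOrder
open scoped RealInnerProductSpace

variable {m n : ℕ}

/-- **WEIGHTED CAUCHY–SCHWARZ ON A WINDOW**: `w ≥ 0` on `F`, `w`, `w·g`, `w·g²` integrable on `F`, `∫_F w > 0` ⊢
`(∫_F w g)² ≤ (∫_F w)(∫_F w g²)` (expand `0 ≤ ∫_F w (g − m)²` at `m = (∫_F w g)∕(∫_F w)`). [folklore] -/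
theorem sq_integral_mul_le {α : Type*} [MeasurableSpace α] {μ : Measure α} {F : Set α} (hF : MeasurableSet F) {w g : α → ℝ}
    (hw : ∀ y ∈ F, 0 ≤ w y) (Iw : IntegrableOn w F μ) (Iwg : IntegrableOn (fun y => w y * g y) F μ)
    (Iwg2 : IntegrableOn (fun y => w y * g y ^ 2) F μ) (hZ : 0 < ∫ y in F, w y ∂μ) :
    (∫ y in F, w y * g y ∂μ) ^ 2 ≤ (∫ y in F, w y ∂μ) * ∫ y in F, w y * g y ^ 2 ∂μ := by
  set Z := ∫ y in F, w y ∂μ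
  set S := ∫ y in F, w y * g y ^ 2 ∂μ
  set A₀ := ∫ y in F, w y * g y ∂μ
  set mm := A₀ / Z with hmm
  have hnn : 0 ≤ ∫ y in F, w y * (g y - mm) ^ 2 ∂μ := setIntegral_nonneg hF fun y hy => mul_nonneg (hw y hy) (sq_nonneg _)
  have I1 : IntegrableOn (fun y => w y * g y ^ 2 - 2 * mm * (w y * g y)) F μ := Iwg2.sub (Iwg.const_mul _)
  have I2 : IntegrableOn (fun y => mm ^ 2 * w y) F μ := Iw.const_mul _
  have I3 : IntegrableOn (fun y => 2 * mm * (w y * g y)) F μ := Iwg.const_mul _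
  have hexp : (∫ y in F, w y * (g y - mm) ^ 2 ∂μ) = S - 2 * mm * A₀ + mm ^ 2 * Z := by
    calc (∫ y in F, w y * (g y - mm) ^ 2 ∂μ)
        = ∫ y in F, (w y * g y ^ 2 - 2 * mm * (w y * g y)) + mm ^ 2 * w y ∂μ := setIntegral_congr_fun hF fun y _ => by ring
      _ = (∫ y in F, w y * g y ^ 2 - 2 * mm * (w y * g y) ∂μ) + ∫ y in F, mm ^ 2 * w y ∂μ := integral_add I1 I2
      _ = ((∫ y in F, w y * g y ^ 2 ∂μ) - ∫ y in F, 2 * mm * (w y * g y) ∂μ) + ∫ y in F, mm ^ 2 * w y ∂μ := by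
          rw [integral_sub Iwg2 I3]
      _ = S - 2 * mm * A₀ + mm ^ 2 * Z := by rw [integral_const_mul, integral_const_mul]
  rw [hexp, hmm] at hnn
  have : S - 2 * (A₀ / Z) * A₀ + (A₀ / Z) ^ 2 * Z = S - A₀ ^ 2 / Z := by field_simp; ring
  rw [this] at hnn
  have h' : A₀ ^ 2 / Z ≤ S := by linarith
  rwa [div_le_iff₀ hZ, mul_comm] at h'

/-- **THE SHARP UPPER DISPLAY** (Brascamp–Lieb's formula with the variance dropped): `V ∈ C²`, `F` measurable bounded, `volume F ≠ 0` ⊢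
`D²V⁺(x)[u,u] ≤ (∫_F e^{−V(x,y)}·D²V(x,y)[(u,0),(u,0)] dy) ∕ ∫_F e^{−V(x,y)} dy` — the TILTED MEAN of the base second derivative. [folklore] -/
theorem iteratedFDeriv_two_negLogFibreWindowMass_le_tiltedMean
    {V : EuclideanSpace ℝ (Fin m) × EuclideanSpace ℝ (Fin n) → ℝ} (hV : ContDiff ℝ 2 V)
    {F : Set (EuclideanSpace ℝ (Fin n))} (hF : MeasurableSet F) (hFb : IsBounded F) (hF0 : volume F ≠ 0)
    (x u : EuclideanSpace ℝ (Fin m)) :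
    iteratedFDeriv ℝ 2 (fun x => -log (∫ y in F, exp (-V (x, y)))) x ![u, u] ≤
      (∫ y in F, exp (-V (x, y)) * fderiv ℝ (fderiv ℝ V) (x, y) (u, 0) (u, 0)) / ∫ y in F, exp (-V (x, y)) := by
  rw [iteratedFDeriv_two_negLogFibreWindowMass hV hF hFb hF0 x u]
  set w : EuclideanSpace ℝ (Fin n) → ℝ := fun y => exp (-V (x, y)) with hw
  set g : EuclideanSpace ℝ (Fin n) → ℝ := fun y => fderiv ℝ V (x, y) (u, 0) with hg
  set h : EuclideanSpace ℝ (Fin n) → ℝ := fun y => fderiv ℝ (fderiv ℝ V) (x, y) (u, 0) (u, 0) with hh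
  have hZ : 0 < ∫ y in F, w y := fibreWindowMass_pos hV.continuous hFb hF0 x
  have hwc : Continuous fun p : EuclideanSpace ℝ (Fin m) × EuclideanSpace ℝ (Fin n) => exp (-V p) :=
    continuous_exp.comp hV.continuous.neg
  have hgc : Continuous fun p : EuclideanSpace ℝ (Fin m) × EuclideanSpace ℝ (Fin n) => fderiv ℝ V p (u, 0) :=
    (hV.continuous_fderiv (by norm_num)).clm_apply continuous_const
  have hhc : Continuous fun p : EuclideanSpace ℝ (Fin m) × EuclideanSpace ℝ (Fin n) => fderiv ℝ (fderiv ℝ V) p (u, 0) (u, 0) :=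
    (((hV.fderiv_right (m := 1) le_rfl).continuous_fderiv one_ne_zero).clm_apply continuous_const).clm_apply continuous_const
  have Iw : IntegrableOn w F := integrableOn_fibreWindow (Φ := fun p => exp (-V p)) hwc hFb x
  have Iwg : IntegrableOn (fun y => w y * g y) F :=
    integrableOn_fibreWindow (Φ := fun p => exp (-V p) * fderiv ℝ V p (u, 0)) (hwc.mul hgc) hFb x
  have Iwg2 : IntegrableOn (fun y => w y * g y ^ 2) F :=
    integrableOn_fibreWindow (Φ := fun p => exp (-V p) * (fderiv ℝ V p (u, 0)) ^ 2) (hwc.mul (hgc.pow 2)) hFb x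
  have Iwh : IntegrableOn (fun y => w y * h y) F :=
    integrableOn_fibreWindow (Φ := fun p => exp (-V p) * fderiv ℝ (fderiv ℝ V) p (u, 0) (u, 0)) (hwc.mul hhc) hFb x
  have hB : (∫ y in F, w y * (g y ^ 2 - h y)) = (∫ y in F, w y * g y ^ 2) - ∫ y in F, w y * h y := by
    rw [← integral_sub Iwg2 Iwh]
    exact integral_congr_ae (ae_of_all _ fun y => by ring)
  have hCS := sq_integral_mul_le hF (fun y _ => (exp_pos _).le) Iw Iwg Iwg2 hZ
  show -(∫ y in F, w y * (g y ^ 2 - h y)) / (∫ y in F, w y) + (∫ y in F, -(w y * g y)) ^ 2 / (∫ y in F, w y) ^ 2 ≤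
    (∫ y in F, w y * h y) / ∫ y in F, w y
  rw [hB, integral_neg, neg_sq, div_add_div _ _ hZ.ne' (pow_ne_zero 2 hZ.ne'),
    div_le_div_iff₀ (mul_pos hZ (pow_pos hZ 2)) hZ]
  nlinarith [hCS, hZ, pow_pos hZ 2, pow_pos hZ 3]

/-- **THE GROWTH LETTER IN HESSIAN CURRENCY IS INHERITED, READ AT THE BASE POINT ONLY**: if `D²V(x,y)[(u,0),(u,0)] ≤ r` for every `y ∈ F`
(e.g. `r = 2·R(u)`, HFFO's upper half) then `D²V⁺(x)[u,u] ≤ r`. [folklore] -/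
theorem iteratedFDeriv_two_negLogFibreWindowMass_le_of_fibrewise
    {V : EuclideanSpace ℝ (Fin m) × EuclideanSpace ℝ (Fin n) → ℝ} (hV : ContDiff ℝ 2 V)
    {F : Set (EuclideanSpace ℝ (Fin n))} (hF : MeasurableSet F) (hFb : IsBounded F) (hF0 : volume F ≠ 0)
    (x u : EuclideanSpace ℝ (Fin m)) {r : ℝ} (hr : ∀ y ∈ F, fderiv ℝ (fderiv ℝ V) (x, y) (u, 0) (u, 0) ≤ r) :
    iteratedFDeriv ℝ 2 (fun x => -log (∫ y in F, exp (-V (x, y)))) x ![u, u] ≤ r := by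
  refine (iteratedFDeriv_two_negLogFibreWindowMass_le_tiltedMean hV hF hFb hF0 x u).trans ?_
  have hZ : 0 < ∫ y in F, exp (-V (x, y)) := fibreWindowMass_pos hV.continuous hFb hF0 x
  rw [div_le_iff₀ hZ]
  have hwc : Continuous fun p : EuclideanSpace ℝ (Fin m) × EuclideanSpace ℝ (Fin n) => exp (-V p) :=
    continuous_exp.comp hV.continuous.neg
  have hhc : Continuous fun p : EuclideanSpace ℝ (Fin m) × EuclideanSpace ℝ (Fin n) => fderiv ℝ (fderiv ℝ V) p (u, 0) (u, 0) :=
    (((hV.fderiv_right (m := 1) le_rfl).continuous_fderiv one_ne_zero).clm_apply continuous_const).clm_apply continuous_const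
  have Iw : IntegrableOn (fun y => exp (-V (x, y))) F := integrableOn_fibreWindow (Φ := fun p => exp (-V p)) hwc hFb x
  have Iwh : IntegrableOn (fun y => exp (-V (x, y)) * fderiv ℝ (fderiv ℝ V) (x, y) (u, 0) (u, 0)) F :=
    integrableOn_fibreWindow (Φ := fun p => exp (-V p) * fderiv ℝ (fderiv ℝ V) p (u, 0) (u, 0)) (hwc.mul hhc) hFb x
  calc (∫ y in F, exp (-V (x, y)) * fderiv ℝ (fderiv ℝ V) (x, y) (u, 0) (u, 0))
      ≤ ∫ y in F, r * exp (-V (x, y)) :=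
        setIntegral_mono_on Iwh (Iw.const_mul r) hF fun y hy => by
          rw [mul_comm r]; exact mul_le_mul_of_nonneg_left (hr y hy) (exp_pos _).le
    _ = r * ∫ y in F, exp (-V (x, y)) := integral_const_mul _ _

/-! ## §4 (LOWER half, leaf-05 g150 block) Tilted fibre integrals as quotients -/

/-- Tilted integrals over a restricted measure are quotients of weighted set integrals:
`∫ g d((μ|_F).tilted(−W)) = (∫_F e^{−W} g dμ) ∕ ∫_F e^{−W} dμ`. [folklore] -/
theorem integral_tilted_restrict_eq_div {α : Type*} [MeasurableSpace α] (μ : Measure α) (F : Set α) (W g : α → ℝ) :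
    ∫ y, g y ∂((μ.restrict F).tilted fun y => -W y) = (∫ y in F, exp (-W y) * g y ∂μ) / ∫ y in F, exp (-W y) ∂μ := by
  rw [integral_tilted, ← integral_div]
  congr 1; ext y; rw [smul_eq_mul]; ring

/-! ## §5 Brascamp–Lieb on the fibre through `x`, test function `∂ᵤV(x,·)` -/

/-- **BRASCAMP–LIEB ON THE FIBRE WINDOW** for the base directional derivative: `V ∈ C²` on `ℝᵐ × ℝⁿ`, `F ⊆ ℝⁿ` convex, measurable,
bounded, `volume F ≠ 0`, and `y ↦ V(x,y)` `λ`-uniformly convex ON `F` (first-order letter between points of `F`, `λ > 0`) ⊢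
`⟨(∂ᵤV)²⟩_x − ⟨∂ᵤV⟩_x² ≤ λ⁻¹⟨‖D_y ∂ᵤV‖²⟩_x`, the tilted means written as quotients of fibre integrals with weight `e^{−V(x,·)}`.
The tree's `…ConvexWindowBrascampLieb.variance_windowTilted_le` BY NAME, with its three integrability letters discharged on the bounded
window. [cite: BrascampLieb1976, Thm 4.1] -/
theorem fibre_variance_le {V : EuclideanSpace ℝ (Fin m) × EuclideanSpace ℝ (Fin n) → ℝ} (hV : ContDiff ℝ 2 V)
    {F : Set (EuclideanSpace ℝ (Fin n))} (hFc : Convex ℝ F) (hF : MeasurableSet F) (hFb : IsBounded F) (hF0 : volume F ≠ 0)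
    {lam : ℝ} (hlam : 0 < lam) (x u : EuclideanSpace ℝ (Fin m))
    (hVF : ∀ y ∈ F, ∀ y' ∈ F,
      V (x, y) + ⟪gradient (fun z => V (x, z)) y, y' - y⟫ + lam / 2 * ‖y' - y‖ ^ 2 ≤ V (x, y')) :
    (∫ y in F, exp (-V (x, y)) * (fderiv ℝ V (x, y) (u, 0)) ^ 2) / (∫ y in F, exp (-V (x, y))) -
        ((∫ y in F, exp (-V (x, y)) * fderiv ℝ V (x, y) (u, 0)) / ∫ y in F, exp (-V (x, y))) ^ 2 ≤
      lam⁻¹ * ((∫ y in F, exp (-V (x, y)) * ‖fderiv ℝ (fun z => fderiv ℝ V (x, z) (u, 0)) y‖ ^ 2) /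
        ∫ y in F, exp (-V (x, y))) := by
  -- the fibre exponent `W = V(x,·)` and the test function `g = ∂ᵤV(x,·)`
  have hWc : Continuous fun z : EuclideanSpace ℝ (Fin n) => V (x, z) := hV.continuous.comp (Continuous.prodMk_right x)
  have hg1 : ContDiff ℝ 1 fun z : EuclideanSpace ℝ (Fin n) => fderiv ℝ V (x, z) (u, 0) :=
    ((hV.fderiv_right (m := 1) le_rfl).comp (contDiff_prodMk_right x)).clm_apply contDiff_const
  have hwc : Continuous fun p : EuclideanSpace ℝ (Fin m) × EuclideanSpace ℝ (Fin n) => exp (-V p) :=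
    continuous_exp.comp hV.continuous.neg
  have hgc : Continuous fun p : EuclideanSpace ℝ (Fin m) × EuclideanSpace ℝ (Fin n) => fderiv ℝ V p (u, 0) :=
    (hV.continuous_fderiv (by norm_num)).clm_apply continuous_const
  have hDgc : Continuous fun z : EuclideanSpace ℝ (Fin n) => fderiv ℝ (fun z : EuclideanSpace ℝ (Fin n) => fderiv ℝ V (x, z) (u, 0)) z :=
    hg1.continuous_fderiv one_ne_zero
  have hZ : IntegrableOn (fun z : EuclideanSpace ℝ (Fin n) => exp (-V (x, z))) F :=
    integrableOn_fibreWindow (Φ := fun p => exp (-V p)) hwc hFb x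
  -- the three integrability letters of `variance_windowTilted_le`, discharged on the bounded window
  have I : ∀ φ : EuclideanSpace ℝ (Fin n) → ℝ, IntegrableOn (fun z => exp (-V (x, z)) * φ z) F →
      Integrable φ ((volume.restrict F).tilted fun z => -V (x, z)) := fun φ hφ =>
    (integrable_tilted_iff hZ φ).2 (hφ.congr (Filter.Eventually.of_forall fun z => by simp only [smul_eq_mul]))
  have h1 : Integrable (fun z => fderiv ℝ V (x, z) (u, 0)) ((volume.restrict F).tilted fun z => -V (x, z)) :=
    I _ (integrableOn_fibreWindow (Φ := fun p => exp (-V p) * fderiv ℝ V p (u, 0)) (hwc.mul hgc) hFb x)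
  have h2 : Integrable (fun z => (fderiv ℝ V (x, z) (u, 0)) ^ 2) ((volume.restrict F).tilted fun z => -V (x, z)) :=
    I _ (integrableOn_fibreWindow (Φ := fun p => exp (-V p) * (fderiv ℝ V p (u, 0)) ^ 2) (hwc.mul (hgc.pow 2)) hFb x)
  have h3 : Integrable (fun z => ‖fderiv ℝ (fun z : EuclideanSpace ℝ (Fin n) => fderiv ℝ V (x, z) (u, 0)) z‖ ^ 2)
      ((volume.restrict F).tilted fun z => -V (x, z)) :=
    I _ (integrableOn_fibreWindow
      (Φ := fun p => exp (-V p) * ‖fderiv ℝ (fun z : EuclideanSpace ℝ (Fin n) => fderiv ℝ V (x, z) (u, 0)) p.2‖ ^ 2)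
      (hwc.mul ((hDgc.comp continuous_snd).norm.pow 2)) hFb x)
  have key := variance_windowTilted_le (V := fun z => V (x, z)) (f := fun z => fderiv ℝ V (x, z) (u, 0))
    hlam hFc hF hF0 hWc (fun y hy y' hy' => hVF y hy y' hy') hZ hg1 h1 h2 h3
  rw [integral_tilted_restrict_eq_div, integral_tilted_restrict_eq_div, integral_tilted_restrict_eq_div] at key
  exact key

/-! ## §6 THE LOWER DISPLAY: the fibre-averaged (scalar) Schur complement bounds `D²V⁺(x)[u,u]` from below -/

/-- **THE LOWER SHARP DISPLAY FROM FIBRE CONVEXITY ALONE**: under the letters of `fibre_variance_le`,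
`(∫_F e^{−V(x,y)}(D²V(x,y)[(u,0),(u,0)] − λ⁻¹‖D_y∂ᵤV(x,y)‖²) dy) ∕ ∫_F e^{−V(x,y)} dy ≤ D²V⁺(x)[u,u]`, `V⁺ = −log ∫_F e^{−V(·,y)} dy` —
Brascamp–Lieb's formula (`…FibreWindowHessian.iteratedFDeriv_two_negLogFibreWindowMass`) with the variance bounded by §5.
[cite: BrascampLieb1976, Thm 4.3] -/
theorem tiltedMean_schur_le_iteratedFDeriv_two_negLogFibreWindowMass
    {V : EuclideanSpace ℝ (Fin m) × EuclideanSpace ℝ (Fin n) → ℝ} (hV : ContDiff ℝ 2 V)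
    {F : Set (EuclideanSpace ℝ (Fin n))} (hFc : Convex ℝ F) (hF : MeasurableSet F) (hFb : IsBounded F) (hF0 : volume F ≠ 0)
    {lam : ℝ} (hlam : 0 < lam) (x u : EuclideanSpace ℝ (Fin m))
    (hVF : ∀ y ∈ F, ∀ y' ∈ F,
      V (x, y) + ⟪gradient (fun z => V (x, z)) y, y' - y⟫ + lam / 2 * ‖y' - y‖ ^ 2 ≤ V (x, y')) :
    (∫ y in F, exp (-V (x, y)) * (fderiv ℝ (fderiv ℝ V) (x, y) (u, 0) (u, 0) -
        lam⁻¹ * ‖fderiv ℝ (fun z => fderiv ℝ V (x, z) (u, 0)) y‖ ^ 2)) / (∫ y in F, exp (-V (x, y))) ≤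
      iteratedFDeriv ℝ 2 (fun x => -log (∫ y in F, exp (-V (x, y)))) x ![u, u] := by
  rw [iteratedFDeriv_two_negLogFibreWindowMass hV hF hFb hF0 x u]
  have hvar := fibre_variance_le hV hFc hF hFb hF0 hlam x u hVF
  -- names for the five fibre integrals
  set Z := ∫ y in F, exp (-V (x, y)) with hZdef
  set A₁ := ∫ y in F, exp (-V (x, y)) * fderiv ℝ V (x, y) (u, 0) with hA₁
  set S := ∫ y in F, exp (-V (x, y)) * (fderiv ℝ V (x, y) (u, 0)) ^ 2 with hS
  set H := ∫ y in F, exp (-V (x, y)) * fderiv ℝ (fderiv ℝ V) (x, y) (u, 0) (u, 0) with hH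
  set D := ∫ y in F, exp (-V (x, y)) * ‖fderiv ℝ (fun z => fderiv ℝ V (x, z) (u, 0)) y‖ ^ 2 with hD
  have hZ : 0 < Z := fibreWindowMass_pos hV.continuous hFb hF0 x
  -- integrability on the bounded window (continuity of the integrands)
  have hwc : Continuous fun p : EuclideanSpace ℝ (Fin m) × EuclideanSpace ℝ (Fin n) => exp (-V p) :=
    continuous_exp.comp hV.continuous.neg
  have hgc : Continuous fun p : EuclideanSpace ℝ (Fin m) × EuclideanSpace ℝ (Fin n) => fderiv ℝ V p (u, 0) :=
    (hV.continuous_fderiv (by norm_num)).clm_apply continuous_const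
  have hhc : Continuous fun p : EuclideanSpace ℝ (Fin m) × EuclideanSpace ℝ (Fin n) => fderiv ℝ (fderiv ℝ V) p (u, 0) (u, 0) :=
    (((hV.fderiv_right (m := 1) le_rfl).continuous_fderiv one_ne_zero).clm_apply continuous_const).clm_apply continuous_const
  have hg1 : ContDiff ℝ 1 fun z : EuclideanSpace ℝ (Fin n) => fderiv ℝ V (x, z) (u, 0) :=
    ((hV.fderiv_right (m := 1) le_rfl).comp (contDiff_prodMk_right x)).clm_apply contDiff_const
  have hDgc : Continuous fun z : EuclideanSpace ℝ (Fin n) => fderiv ℝ (fun z : EuclideanSpace ℝ (Fin n) => fderiv ℝ V (x, z) (u, 0)) z :=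
    hg1.continuous_fderiv one_ne_zero
  have Iwg : IntegrableOn (fun y => exp (-V (x, y)) * fderiv ℝ V (x, y) (u, 0)) F :=
    integrableOn_fibreWindow (Φ := fun p => exp (-V p) * fderiv ℝ V p (u, 0)) (hwc.mul hgc) hFb x
  have Iwg2 : IntegrableOn (fun y => exp (-V (x, y)) * (fderiv ℝ V (x, y) (u, 0)) ^ 2) F :=
    integrableOn_fibreWindow (Φ := fun p => exp (-V p) * (fderiv ℝ V p (u, 0)) ^ 2) (hwc.mul (hgc.pow 2)) hFb x
  have Iwh : IntegrableOn (fun y => exp (-V (x, y)) * fderiv ℝ (fderiv ℝ V) (x, y) (u, 0) (u, 0)) F :=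
    integrableOn_fibreWindow (Φ := fun p => exp (-V p) * fderiv ℝ (fderiv ℝ V) p (u, 0) (u, 0)) (hwc.mul hhc) hFb x
  have IwD : IntegrableOn (fun y => exp (-V (x, y)) * ‖fderiv ℝ (fun z : EuclideanSpace ℝ (Fin n) => fderiv ℝ V (x, z) (u, 0)) y‖ ^ 2) F :=
    integrableOn_fibreWindow
      (Φ := fun p => exp (-V p) * ‖fderiv ℝ (fun z : EuclideanSpace ℝ (Fin n) => fderiv ℝ V (x, z) (u, 0)) p.2‖ ^ 2)
      (hwc.mul ((hDgc.comp continuous_snd).norm.pow 2)) hFb x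
  -- the two composite integrals split
  have hB : (∫ y in F, exp (-V (x, y)) * ((fderiv ℝ V (x, y) (u, 0)) ^ 2 - fderiv ℝ (fderiv ℝ V) (x, y) (u, 0) (u, 0))) = S - H := by
    rw [hS, hH, ← integral_sub Iwg2 Iwh]
    exact integral_congr_ae (ae_of_all _ fun y => by ring)
  have hL : (∫ y in F, exp (-V (x, y)) * (fderiv ℝ (fderiv ℝ V) (x, y) (u, 0) (u, 0) -
      lam⁻¹ * ‖fderiv ℝ (fun z => fderiv ℝ V (x, z) (u, 0)) y‖ ^ 2)) = H - lam⁻¹ * D := by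
    rw [hH, hD, ← integral_const_mul, ← integral_sub Iwh (IwD.const_mul _)]
    exact integral_congr_ae (ae_of_all _ fun y => by ring)
  have hA : (∫ y in F, -(exp (-V (x, y)) * fderiv ℝ V (x, y) (u, 0))) = -A₁ := by rw [hA₁, integral_neg]
  rw [hB, hL, hA]
  have hid : (H - lam⁻¹ * D) / Z = (-(S - H) / Z + (-A₁) ^ 2 / Z ^ 2) - (lam⁻¹ * (D / Z) - (S / Z - (A₁ / Z) ^ 2)) := by
    field_simp
    ring
  rw [hid]
  linarith [hvar]

/-- **THE LOWER LETTER IS INHERITED, READ ON THE FIBRE THROUGH THE BASE POINT**: under the letters of `fibre_variance_le`, if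
`r ≤ D²V(x,y)[(u,0),(u,0)] − λ⁻¹‖D_y∂ᵤV(x,y)‖²` for every `y ∈ F` then `r ≤ D²V⁺(x)[u,u]`. [folklore] -/
theorem le_iteratedFDeriv_two_negLogFibreWindowMass_of_fibrewise
    {V : EuclideanSpace ℝ (Fin m) × EuclideanSpace ℝ (Fin n) → ℝ} (hV : ContDiff ℝ 2 V)
    {F : Set (EuclideanSpace ℝ (Fin n))} (hFc : Convex ℝ F) (hF : MeasurableSet F) (hFb : IsBounded F) (hF0 : volume F ≠ 0)
    {lam : ℝ} (hlam : 0 < lam) (x u : EuclideanSpace ℝ (Fin m))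
    (hVF : ∀ y ∈ F, ∀ y' ∈ F,
      V (x, y) + ⟪gradient (fun z => V (x, z)) y, y' - y⟫ + lam / 2 * ‖y' - y‖ ^ 2 ≤ V (x, y'))
    {r : ℝ} (hr : ∀ y ∈ F, r ≤ fderiv ℝ (fderiv ℝ V) (x, y) (u, 0) (u, 0) -
      lam⁻¹ * ‖fderiv ℝ (fun z => fderiv ℝ V (x, z) (u, 0)) y‖ ^ 2) :
    r ≤ iteratedFDeriv ℝ 2 (fun x => -log (∫ y in F, exp (-V (x, y)))) x ![u, u] := by
  refine le_trans ?_ (tiltedMean_schur_le_iteratedFDeriv_two_negLogFibreWindowMass hV hFc hF hFb hF0 hlam x u hVF)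
  have hZ : 0 < ∫ y in F, exp (-V (x, y)) := fibreWindowMass_pos hV.continuous hFb hF0 x
  rw [le_div_iff₀ hZ]
  have hwc : Continuous fun p : EuclideanSpace ℝ (Fin m) × EuclideanSpace ℝ (Fin n) => exp (-V p) :=
    continuous_exp.comp hV.continuous.neg
  have hhc : Continuous fun p : EuclideanSpace ℝ (Fin m) × EuclideanSpace ℝ (Fin n) => fderiv ℝ (fderiv ℝ V) p (u, 0) (u, 0) :=
    (((hV.fderiv_right (m := 1) le_rfl).continuous_fderiv one_ne_zero).clm_apply continuous_const).clm_apply continuous_const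
  have hg1 : ContDiff ℝ 1 fun z : EuclideanSpace ℝ (Fin n) => fderiv ℝ V (x, z) (u, 0) :=
    ((hV.fderiv_right (m := 1) le_rfl).comp (contDiff_prodMk_right x)).clm_apply contDiff_const
  have hDgc : Continuous fun z : EuclideanSpace ℝ (Fin n) => fderiv ℝ (fun z : EuclideanSpace ℝ (Fin n) => fderiv ℝ V (x, z) (u, 0)) z :=
    hg1.continuous_fderiv one_ne_zero
  have Iw : IntegrableOn (fun y => exp (-V (x, y))) F := integrableOn_fibreWindow (Φ := fun p => exp (-V p)) hwc hFb x
  have IL : IntegrableOn (fun y => exp (-V (x, y)) * (fderiv ℝ (fderiv ℝ V) (x, y) (u, 0) (u, 0) -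
      lam⁻¹ * ‖fderiv ℝ (fun z => fderiv ℝ V (x, z) (u, 0)) y‖ ^ 2)) F :=
    integrableOn_fibreWindow
      (Φ := fun p => exp (-V p) * (fderiv ℝ (fderiv ℝ V) p (u, 0) (u, 0) -
        lam⁻¹ * ‖fderiv ℝ (fun z : EuclideanSpace ℝ (Fin n) => fderiv ℝ V (x, z) (u, 0)) p.2‖ ^ 2))
      (hwc.mul (hhc.sub (((hDgc.comp continuous_snd).norm.pow 2).const_mul _))) hFb x
  calc r * ∫ y in F, exp (-V (x, y)) = ∫ y in F, r * exp (-V (x, y)) := (integral_const_mul _ _).symm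
    _ ≤ ∫ y in F, exp (-V (x, y)) * (fderiv ℝ (fderiv ℝ V) (x, y) (u, 0) (u, 0) -
          lam⁻¹ * ‖fderiv ℝ (fun z => fderiv ℝ V (x, z) (u, 0)) y‖ ^ 2) :=
        setIntegral_mono_on (Iw.const_mul r) IL hF fun y hy => by
          rw [mul_comm r]; exact mul_le_mul_of_nonneg_left (hr y hy) (exp_pos _).le

/-- **THE CONVEXITY MODULUS PASSES A FLUCTUATION INTEGRAL WITH THE LOSS `b²∕λ`**: under the letters of `fibre_variance_le`, if
`a ≤ D²V(x,y)[(u,0),(u,0)]` and `‖D_y∂ᵤV(x,y)‖ ≤ b` for every `y ∈ F`, then `a − b²∕λ ≤ D²V⁺(x)[u,u]` — the base-direction Hessian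
letter of the fibre integrand survives `V ↦ −log ∫_F e^{−V(·,y)} dy` up to the mixed-derivative price `b²∕λ`, with NO joint convexity
of `V` asked (Brascamp–Lieb 1976, Thm 4.3, through §5 ∕ §6). [folklore] -/
theorem le_iteratedFDeriv_two_negLogFibreWindowMass_of_bounds
    {V : EuclideanSpace ℝ (Fin m) × EuclideanSpace ℝ (Fin n) → ℝ} (hV : ContDiff ℝ 2 V)
    {F : Set (EuclideanSpace ℝ (Fin n))} (hFc : Convex ℝ F) (hF : MeasurableSet F) (hFb : IsBounded F) (hF0 : volume F ≠ 0)
    {lam : ℝ} (hlam : 0 < lam) (x u : EuclideanSpace ℝ (Fin m))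
    (hVF : ∀ y ∈ F, ∀ y' ∈ F,
      V (x, y) + ⟪gradient (fun z => V (x, z)) y, y' - y⟫ + lam / 2 * ‖y' - y‖ ^ 2 ≤ V (x, y'))
    {a b : ℝ} (ha : ∀ y ∈ F, a ≤ fderiv ℝ (fderiv ℝ V) (x, y) (u, 0) (u, 0))
    (hb : ∀ y ∈ F, ‖fderiv ℝ (fun z => fderiv ℝ V (x, z) (u, 0)) y‖ ≤ b) :
    a - b ^ 2 / lam ≤ iteratedFDeriv ℝ 2 (fun x => -log (∫ y in F, exp (-V (x, y)))) x ![u, u] := by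
  refine le_iteratedFDeriv_two_negLogFibreWindowMass_of_fibrewise hV hFc hF hFb hF0 hlam x u hVF fun y hy => ?_
  have h1 : ‖fderiv ℝ (fun z => fderiv ℝ V (x, z) (u, 0)) y‖ ^ 2 ≤ b ^ 2 :=
    pow_le_pow_left₀ (norm_nonneg _) (hb y hy) 2
  have h2 : lam⁻¹ * ‖fderiv ℝ (fun z => fderiv ℝ V (x, z) (u, 0)) y‖ ^ 2 ≤ b ^ 2 / lam := by
    rw [div_eq_inv_mul]; exact mul_le_mul_of_nonneg_left h1 (inv_pos.2 hlam).le
  linarith [ha y hy]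

/-! ## §7 THE TWO-SIDED DISPLAY (the upper half `iteratedFDeriv_two_negLogFibreWindowMass_le_of_fibrewise` + §6's lower half) -/

/-- **THE TWO-SIDED HESSIAN DISPLAY OF A FIBRE-WINDOW MARGINAL, READ ON THE FIBRE THROUGH THE BASE POINT**: `V ∈ C²`; `F` convex,
measurable, bounded, `volume F ≠ 0`; `y ↦ V(x,y)` `λ`-uniformly convex ON `F` (first-order letter); fibrewise letters on `F`:
`a ≤ D²V(x,y)[(u,0),(u,0)] ≤ A` and `‖D_y∂ᵤV(x,y)‖ ≤ b` ⊢ `a − b²∕λ ≤ D²V⁺(x)[u,u] ≤ A` — Brascamp–Lieb's formula with the variance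
bounded below by `0` (weighted Cauchy–Schwarz, `sq_integral_mul_le`) and above by `λ⁻¹⟨‖D_y∂ᵤV‖²⟩` (Brascamp–Lieb on the fibre, §5–§6). [folklore] -/
theorem hessian_twoSided_of_fibrewise
    {V : EuclideanSpace ℝ (Fin m) × EuclideanSpace ℝ (Fin n) → ℝ} (hV : ContDiff ℝ 2 V)
    {F : Set (EuclideanSpace ℝ (Fin n))} (hFc : Convex ℝ F) (hF : MeasurableSet F) (hFb : IsBounded F) (hF0 : volume F ≠ 0)
    {lam : ℝ} (hlam : 0 < lam) (x u : EuclideanSpace ℝ (Fin m))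
    (hVF : ∀ y ∈ F, ∀ y' ∈ F,
      V (x, y) + ⟪gradient (fun z => V (x, z)) y, y' - y⟫ + lam / 2 * ‖y' - y‖ ^ 2 ≤ V (x, y'))
    {a A b : ℝ} (ha : ∀ y ∈ F, a ≤ fderiv ℝ (fderiv ℝ V) (x, y) (u, 0) (u, 0))
    (hA : ∀ y ∈ F, fderiv ℝ (fderiv ℝ V) (x, y) (u, 0) (u, 0) ≤ A)
    (hb : ∀ y ∈ F, ‖fderiv ℝ (fun z => fderiv ℝ V (x, z) (u, 0)) y‖ ≤ b) :
    a - b ^ 2 / lam ≤ iteratedFDeriv ℝ 2 (fun x => -log (∫ y in F, exp (-V (x, y)))) x ![u, u] ∧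
      iteratedFDeriv ℝ 2 (fun x => -log (∫ y in F, exp (-V (x, y)))) x ![u, u] ≤ A :=
  ⟨le_iteratedFDeriv_two_negLogFibreWindowMass_of_bounds hV hFc hF hFb hF0 hlam x u hVF ha hb,
    iteratedFDeriv_two_negLogFibreWindowMass_le_of_fibrewise hV hF hFb hF0 x u hA⟩

/-! ## §8 (leaf-05 g150 block) The letters in HESSIAN currency only: the mixed block bounds `‖D_y∂ᵤV‖`, the fibre Hessian floor gives the first-order
fibre letter (the tree's `…HessianFormFirstOrder` BY NAME) -/

/-- **THE MIXED BLOCK OF THE JOINT HESSIAN BOUNDS `‖D_y ∂ᵤV‖`**: `V ∈ C²`; if `|D²V(x,y)[(0,v),(u,0)]| ≤ b‖v‖` for all `v` (`b ≥ 0`)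
then `‖D_y(∂ᵤV(x,·))(y)‖ ≤ b` — the derivative of `z ↦ DV(x,z)(u,0)` at `y` IS `v ↦ D²V(x,y)[(0,v)](u,0)`. [folklore] -/
theorem norm_fderiv_baseDeriv_le_of_mixed {V : EuclideanSpace ℝ (Fin m) × EuclideanSpace ℝ (Fin n) → ℝ} (hV : ContDiff ℝ 2 V)
    (x u : EuclideanSpace ℝ (Fin m)) (y : EuclideanSpace ℝ (Fin n)) {b : ℝ} (hb0 : 0 ≤ b)
    (hb : ∀ v : EuclideanSpace ℝ (Fin n), |fderiv ℝ (fderiv ℝ V) (x, y) (0, v) (u, 0)| ≤ b * ‖v‖) :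
    ‖fderiv ℝ (fun z => fderiv ℝ V (x, z) (u, 0)) y‖ ≤ b := by
  -- the derivative of `z ↦ DV(x,z)` at `y` is `D²V(x,y) ∘ inr`
  have hG : HasFDerivAt (fun z : EuclideanSpace ℝ (Fin n) => fderiv ℝ V (x, z))
      ((fderiv ℝ (fderiv ℝ V) (x, y)).comp (ContinuousLinearMap.inr ℝ (EuclideanSpace ℝ (Fin m)) (EuclideanSpace ℝ (Fin n)))) y :=
    ((((hV.fderiv_right (m := 1) le_rfl).differentiable one_ne_zero) (x, y)).hasFDerivAt).comp y (hasFDerivAt_prodMk_right x y)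
  -- hence the derivative of `z ↦ DV(x,z)(u,0)` is its evaluation at `(u,0)`
  have hg : HasFDerivAt (fun z : EuclideanSpace ℝ (Fin n) => fderiv ℝ V (x, z) (u, 0))
      (((fderiv ℝ (fderiv ℝ V) (x, y)).comp
        (ContinuousLinearMap.inr ℝ (EuclideanSpace ℝ (Fin m)) (EuclideanSpace ℝ (Fin n)))).flip (u, 0)) y := by
    have h := hG.clm_apply (hasFDerivAt_const ((u, 0) : EuclideanSpace ℝ (Fin m) × EuclideanSpace ℝ (Fin n)) y)
    simpa using h
  rw [hg.fderiv]
  refine ContinuousLinearMap.opNorm_le_bound _ hb0 fun v => ?_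
  simpa [Real.norm_eq_abs] using hb v

/-- **THE LOWER DISPLAY FROM HESSIAN LETTERS ONLY**: `V ∈ C²`; `F` convex, measurable, bounded, `volume F ≠ 0`; on the fibre through
`x`: the FIBRE HESSIAN FLOOR `λ‖v‖² ≤ D²(V(x,·))(y)[v,v]` (`λ > 0`), the base floor `a ≤ D²V(x,y)[(u,0),(u,0)]` and the mixed bound
`|D²V(x,y)[(0,v),(u,0)]| ≤ b‖v‖` for `y ∈ F` ⊢ `a − b²∕λ ≤ D²V⁺(x)[u,u]`.  The first-order fibre letter is supplied by the tree's
`…HessianFormFirstOrder.firstOrderOn_form_of_hessianOn_lower` (with the form `Q = (λ∕2)‖·‖²`) BY NAME. [folklore] -/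
theorem le_iteratedFDeriv_two_negLogFibreWindowMass_of_hessianLetters
    {V : EuclideanSpace ℝ (Fin m) × EuclideanSpace ℝ (Fin n) → ℝ} (hV : ContDiff ℝ 2 V)
    {F : Set (EuclideanSpace ℝ (Fin n))} (hFc : Convex ℝ F) (hF : MeasurableSet F) (hFb : IsBounded F) (hF0 : volume F ≠ 0)
    {lam : ℝ} (hlam : 0 < lam) (x u : EuclideanSpace ℝ (Fin m))
    (hfib : ∀ y ∈ F, ∀ v : EuclideanSpace ℝ (Fin n), lam * ‖v‖ ^ 2 ≤ iteratedFDeriv ℝ 2 (fun z => V (x, z)) y ![v, v])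
    {a b : ℝ} (hb0 : 0 ≤ b) (ha : ∀ y ∈ F, a ≤ fderiv ℝ (fderiv ℝ V) (x, y) (u, 0) (u, 0))
    (hb : ∀ y ∈ F, ∀ v : EuclideanSpace ℝ (Fin n), |fderiv ℝ (fderiv ℝ V) (x, y) (0, v) (u, 0)| ≤ b * ‖v‖) :
    a - b ^ 2 / lam ≤ iteratedFDeriv ℝ 2 (fun x => -log (∫ y in F, exp (-V (x, y)))) x ![u, u] := by
  have hW2 : ContDiff ℝ 2 (fun z : EuclideanSpace ℝ (Fin n) => V (x, z)) := hV.comp (contDiff_prodMk_right x)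
  have hVF := firstOrderOn_form_of_hessianOn_lower hFc hW2 (fun v => lam / 2 * ‖v‖ ^ 2)
    (fun y hy v => by have h := hfib y hy v; linarith)
  exact le_iteratedFDeriv_two_negLogFibreWindowMass_of_bounds hV hFc hF hFb hF0 hlam x u
    (fun y hy y' hy' => hVF y hy y' hy') ha (fun y hy => norm_fderiv_baseDeriv_le_of_mixed hV x u y hb0 (hb y hy))

/-! ## §9 THE TWO-SIDED DISPLAY FROM HESSIAN LETTERS ONLY (Hessian in ⟹ Hessian out, one fluctuation integral) -/

/-- **HESSIAN IN, HESSIAN OUT**: `V ∈ C²`; `F` convex, measurable, bounded, `volume F ≠ 0`; on the fibre through `x`: the fibre Hessian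
floor `λ‖v‖² ≤ D²(V(x,·))(y)[v,v]` (`λ > 0`), the base block `a ≤ D²V(x,y)[(u,0),(u,0)] ≤ A`, the mixed block `|D²V(x,y)[(0,v),(u,0)]| ≤ b‖v‖`
(`b ≥ 0`), all for `y ∈ F` ⊢ `a − b²∕λ ≤ D²V⁺(x)[u,u] ≤ A`, `V⁺ = −log ∫_F e^{−V(·,y)} dy`. [folklore] -/
theorem hessian_twoSided_of_hessianLetters
    {V : EuclideanSpace ℝ (Fin m) × EuclideanSpace ℝ (Fin n) → ℝ} (hV : ContDiff ℝ 2 V)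
    {F : Set (EuclideanSpace ℝ (Fin n))} (hFc : Convex ℝ F) (hF : MeasurableSet F) (hFb : IsBounded F) (hF0 : volume F ≠ 0)
    {lam : ℝ} (hlam : 0 < lam) (x u : EuclideanSpace ℝ (Fin m))
    (hfib : ∀ y ∈ F, ∀ v : EuclideanSpace ℝ (Fin n), lam * ‖v‖ ^ 2 ≤ iteratedFDeriv ℝ 2 (fun z => V (x, z)) y ![v, v])
    {a A b : ℝ} (hb0 : 0 ≤ b) (ha : ∀ y ∈ F, a ≤ fderiv ℝ (fderiv ℝ V) (x, y) (u, 0) (u, 0))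
    (hA : ∀ y ∈ F, fderiv ℝ (fderiv ℝ V) (x, y) (u, 0) (u, 0) ≤ A)
    (hb : ∀ y ∈ F, ∀ v : EuclideanSpace ℝ (Fin n), |fderiv ℝ (fderiv ℝ V) (x, y) (0, v) (u, 0)| ≤ b * ‖v‖) :
    a - b ^ 2 / lam ≤ iteratedFDeriv ℝ 2 (fun x => -log (∫ y in F, exp (-V (x, y)))) x ![u, u] ∧
      iteratedFDeriv ℝ 2 (fun x => -log (∫ y in F, exp (-V (x, y)))) x ![u, u] ≤ A :=
  ⟨le_iteratedFDeriv_two_negLogFibreWindowMass_of_hessianLetters hV hFc hF hFb hF0 hlam x u hfib hb0 ha hb,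
    iteratedFDeriv_two_negLogFibreWindowMass_le_of_fibrewise hV hF hFb hF0 x u hA⟩

end Summit.QuantumFields.BalabanUV.T4Continuum.NE7b.FibreWindowHessianBounds
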